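import Summits.NavierStokesRegularity.NavierStokesRegularity.Theorems.ExtremiserTransienceNearExtremalTransienceExtremiserLiouvilleConstantSpeedSlideQuotient
import Literature.Analysis.FunctionSpaces.SmoothParametricIntegral
import HarnessLib

/-!
# Crux `ExtremiserTransience.NearExtremalTransience` (stmt-NavierStokesRegularity-21883), line `extremiser_liouville`,
# stub K1b — the discrete slide direction `φ̂_h`: SMOOTHNESS AND UNIFORM BOUNDS (blueprint L1, part 2)

`--supports stmt-NavierStokesRegularity-21883` (helper).  Author: prover seat `ns-el-k1b` (g8).  Sequel of `…SlideQuotient`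
(`φ̂_h(x) = g(x₂)V(x) − g(x₂−h)V(x−he₂) − (∫_{−h}^{0} g′(x₂+t)V₂(x+te₂)dt)e₂`, divergence free and inward pointing).
Here: the remaining pointwise hypotheses of the global KKT lemma `ext_firstVariation_le_of_inner_le_global`:
* `contDiff_slideQuotient` : `φ̂_h ∈ C^∞` (`V, g ∈ C^∞`; the sliding integral by `contDiff_parametric_intervalIntegral`);
* `fderiv_verticalIntegral_eq` : `D∫_{a}^{b}G(· + te₂)dt = ∫_{a}^{b}DG(· + te₂)dt`;
* `norm_slideQuotient_le` : `‖φ̂_h‖ ≤ 2K_gC_V + |h|K_γC_V`, `‖Dφ̂_h‖ ≤ 2(K_gB + K_γC_V) + |h|(K_γB + K_γ′C_V)`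
  (`|g| ≤ K_g`, `|g′| ≤ K_γ`, `|g″| ≤ K_γ′`, `‖V‖ ≤ C_V`, `‖DV‖ ≤ B`).
* `inner_slideQuotient_nonneg_of_farLayer` : the GLOBAL form of inwardness (`g′ = 0` off `[−T,T]`, `‖V‖² ≤ 2‖c‖²` on
  `{|x₂| ≤ T + h}` ⇒ `⟪c + V, φ̂_h⟫ ≥ 0` everywhere).
(The `L²` conditions `D¹φ̂_h, D²φ̂_h ∈ L²` follow in `…SlideQuotientL2`.)

WHAT THIS IS NOT: K1b is NOT proved; nothing here proves NS regularity. [folklore]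
-/

noncomputable section

open Set Filter Topology MeasureTheory Metric Function InnerProductSpace
open scoped ENNReal NNReal Topology InnerProductSpace RealInnerProductSpace ContDiff
open Literature.Analysis.FluidPDE Literature.Analysis

namespace Summit.NavierStokesRegularity.NavierStokesRegularity.Theorems

-- the problem directory repeats the summit name (`NavierStokesRegularity/NavierStokesRegularity`)
set_option linter.dupNamespace false

namespace ExtremiserLiouville

open DepletionLadder.KStar

variable {V : EuclideanSpace ℝ (Fin 3) → EuclideanSpace ℝ (Fin 3)} {c : EuclideanSpace ℝ (Fin 3)} {g : ℝ → ℝ}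

/-! ## 4. Smoothness and uniform bounds of the discrete slide direction -/

/-- `|yᵢ| ≤ ‖y‖` on `ℝ³`. [folklore] -/
theorem abs_apply_le_norm (y : EuclideanSpace ℝ (Fin 3)) (i : Fin 3) : |y i| ≤ ‖y‖ := by
  have := PiLp.norm_apply_le (p := 2) y i; rwa [Real.norm_eq_abs] at this

/-- The coordinate projection `dx₂` has operator norm `≤ 1`. [folklore] -/
theorem norm_proj_two_le : ‖(EuclideanSpace.proj (2 : Fin 3) : EuclideanSpace ℝ (Fin 3) →L[ℝ] ℝ)‖ ≤ 1 := by
  refine ContinuousLinearMap.opNorm_le_bound _ zero_le_one fun y => ?_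
  rw [one_mul, Real.norm_eq_abs]
  exact abs_apply_le_norm y 2

/-- **The discrete slide direction is smooth** (`V, g ∈ C^∞`; the sliding integral is a smooth parametric integral).
[folklore] -/
theorem contDiff_slideQuotient (hV : ContDiff ℝ ∞ V) (hg : ContDiff ℝ ∞ g) (h : ℝ) :
    ContDiff ℝ ∞ fun x : EuclideanSpace ℝ (Fin 3) =>
      g (x 2) • V x - g ((x + (-h) • EuclideanSpace.single (2 : Fin 3) (1 : ℝ)) 2) •
          V (x + (-h) • EuclideanSpace.single (2 : Fin 3) (1 : ℝ)) -
        (∫ t in (-h)..0, deriv g ((x + t • EuclideanSpace.single (2 : Fin 3) (1 : ℝ)) 2) *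
            V (x + t • EuclideanSpace.single (2 : Fin 3) (1 : ℝ)) 2) • EuclideanSpace.single (2 : Fin 3) (1 : ℝ) := by
  set e₂ : EuclideanSpace ℝ (Fin 3) := EuclideanSpace.single (2 : Fin 3) (1 : ℝ) with he₂
  have hproj : ContDiff ℝ ∞ fun y : EuclideanSpace ℝ (Fin 3) => y 2 :=
    (EuclideanSpace.proj (2 : Fin 3) : EuclideanSpace ℝ (Fin 3) →L[ℝ] ℝ).contDiff
  have hΨ : ContDiff ℝ ∞ fun y : EuclideanSpace ℝ (Fin 3) => g (y 2) • V y := (hg.comp hproj).smul hV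
  have hΨa : ContDiff ℝ ∞ fun y : EuclideanSpace ℝ (Fin 3) => g ((y + (-h) • e₂) 2) • V (y + (-h) • e₂) :=
    hΨ.comp (contDiff_id.add contDiff_const)
  have hγ : ContDiff ℝ ∞ (deriv g) := (contDiff_infty_iff_deriv.mp hg).2
  have hG : ContDiff ℝ ∞ fun y : EuclideanSpace ℝ (Fin 3) => deriv g (y 2) * V y 2 :=
    (hγ.comp hproj).mul (hproj.comp hV)
  have hH : ContDiff ℝ ∞ fun q : ℝ × EuclideanSpace ℝ (Fin 3) => deriv g ((q.2 + q.1 • e₂) 2) * V (q.2 + q.1 • e₂) 2 :=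
    hG.comp (contDiff_snd.add (contDiff_fst.smul contDiff_const))
  have hF : ContDiff ℝ ∞ fun y : EuclideanSpace ℝ (Fin 3) => ∫ t in (-h)..0, deriv g ((y + t • e₂) 2) * V (y + t • e₂) 2 :=
    Literature.Analysis.FunctionSpaces.contDiff_parametric_intervalIntegral
      (H := fun q : ℝ × EuclideanSpace ℝ (Fin 3) => deriv g ((q.2 + q.1 • e₂) 2) * V (q.2 + q.1 • e₂) 2) hH (-h) 0
  exact (hΨ.sub hΨa).sub (hF.smul contDiff_const)

/-- Derivative of `y ↦ g(y₂)V(y)`: `g(y₂)DV(y) + V(y) ⊗ g′(y₂)dx₂`. [folklore] -/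
theorem hasFDerivAt_axialWeight_smul (hVd : Differentiable ℝ V) (hgd : Differentiable ℝ g) (y : EuclideanSpace ℝ (Fin 3)) :
    HasFDerivAt (fun z : EuclideanSpace ℝ (Fin 3) => g (z 2) • V z)
      (g (y 2) • fderiv ℝ V y + (deriv g (y 2) • (EuclideanSpace.proj (2 : Fin 3) : EuclideanSpace ℝ (Fin 3) →L[ℝ] ℝ)).smulRight (V y)) y :=
  (hasFDerivAt_comp_coord hgd 2 y).smul (hVd y).hasFDerivAt

/-- `‖D(g(x₂)V)(y)‖ ≤ K_g‖DV(y)‖ + K_γ‖V(y)‖`. [folklore] -/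
theorem norm_fderiv_axialWeight_smul_le (hVd : Differentiable ℝ V) (hgd : Differentiable ℝ g) {Kg Kγ : ℝ}
    (hKg : ∀ s, |g s| ≤ Kg) (hKγ : ∀ s, |deriv g s| ≤ Kγ) (y : EuclideanSpace ℝ (Fin 3)) :
    ‖fderiv ℝ (fun z : EuclideanSpace ℝ (Fin 3) => g (z 2) • V z) y‖ ≤ Kg * ‖fderiv ℝ V y‖ + Kγ * ‖V y‖ := by
  rw [(hasFDerivAt_axialWeight_smul hVd hgd y).fderiv]
  refine (norm_add_le _ _).trans (add_le_add ?_ ?_)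
  · rw [norm_smul, Real.norm_eq_abs]
    exact mul_le_mul_of_nonneg_right (hKg _) (norm_nonneg _)
  · rw [ContinuousLinearMap.norm_smulRight_apply, norm_smul, Real.norm_eq_abs]
    have h1 : |deriv g (y 2)| * ‖(EuclideanSpace.proj (2 : Fin 3) : EuclideanSpace ℝ (Fin 3) →L[ℝ] ℝ)‖ ≤ Kγ * 1 :=
      mul_le_mul (hKγ (y 2)) norm_proj_two_le (norm_nonneg _) ((abs_nonneg (deriv g 0)).trans (hKγ 0))
    rw [mul_one] at h1
    exact mul_le_mul_of_nonneg_right h1 (norm_nonneg _)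

/-- Derivative of the sliding integral: `D(∫_{a}^{b} G(· + te₂)dt)(x) = ∫_{a}^{b} DG(x + te₂)dt` (`G ∈ C¹`). [folklore] -/
theorem fderiv_verticalIntegral_eq {G : EuclideanSpace ℝ (Fin 3) → ℝ} (hG : ContDiff ℝ 1 G) (a b : ℝ)
    (x : EuclideanSpace ℝ (Fin 3)) :
    fderiv ℝ (fun y : EuclideanSpace ℝ (Fin 3) => ∫ t in a..b, G (y + t • EuclideanSpace.single (2 : Fin 3) (1 : ℝ))) x =
      ∫ t in a..b, fderiv ℝ G (x + t • EuclideanSpace.single (2 : Fin 3) (1 : ℝ)) := by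
  set e₂ : EuclideanSpace ℝ (Fin 3) := EuclideanSpace.single (2 : Fin 3) (1 : ℝ) with he₂
  have hF := contDiff_uncurry_comp_add_smul hG
  rw [Literature.Analysis.Calculus.fderiv_intervalIntegral_eq_partialFDerivFst hF one_ne_zero a b]
  refine intervalIntegral.integral_congr fun t _ => ?_
  show Literature.Analysis.Calculus.partialFDerivFst (fun (y : EuclideanSpace ℝ (Fin 3)) (t : ℝ) => G (y + t • e₂)) x t =
    fderiv ℝ G (x + t • e₂)
  rw [← Literature.Analysis.Calculus.fderiv_eq_partialFDerivFst hF one_ne_zero x t]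
  show fderiv ℝ (fun y : EuclideanSpace ℝ (Fin 3) => G (y + t • e₂)) x = fderiv ℝ G (x + t • e₂)
  rw [fderiv_comp_add_right]

/-- `‖D(g′(x₂)V₂)(y)‖ ≤ K_γ‖DV(y)‖ + K_γ′‖V(y)‖`. [folklore] -/
theorem norm_fderiv_axialWeight_mul_coord_le (hVd : Differentiable ℝ V) (hγd : Differentiable ℝ (deriv g)) {Kγ Kγ' : ℝ}
    (hKγ : ∀ s, |deriv g s| ≤ Kγ) (hKγ' : ∀ s, |deriv (deriv g) s| ≤ Kγ') (y : EuclideanSpace ℝ (Fin 3)) :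
    ‖fderiv ℝ (fun z : EuclideanSpace ℝ (Fin 3) => deriv g (z 2) * V z 2) y‖ ≤ Kγ * ‖fderiv ℝ V y‖ + Kγ' * ‖V y‖ := by
  have hV2 : HasFDerivAt (fun z => V z 2)
      ((EuclideanSpace.proj (2 : Fin 3) : EuclideanSpace ℝ (Fin 3) →L[ℝ] ℝ).comp (fderiv ℝ V y)) y :=
    (EuclideanSpace.proj (2 : Fin 3) : EuclideanSpace ℝ (Fin 3) →L[ℝ] ℝ).hasFDerivAt.comp y (hVd y).hasFDerivAt
  have hm : HasFDerivAt (fun z : EuclideanSpace ℝ (Fin 3) => deriv g (z 2) * V z 2)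
      (deriv g (y 2) • ((EuclideanSpace.proj (2 : Fin 3) : EuclideanSpace ℝ (Fin 3) →L[ℝ] ℝ).comp (fderiv ℝ V y)) +
        V y 2 • (deriv (deriv g) (y 2) • (EuclideanSpace.proj (2 : Fin 3) : EuclideanSpace ℝ (Fin 3) →L[ℝ] ℝ))) y :=
    (hasFDerivAt_comp_coord hγd 2 y).mul hV2
  rw [hm.fderiv]
  refine (norm_add_le _ _).trans (add_le_add ?_ ?_)
  · rw [norm_smul, Real.norm_eq_abs]
    refine mul_le_mul (hKγ (y 2)) ?_ (norm_nonneg _) ((abs_nonneg (deriv g 0)).trans (hKγ 0))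
    calc ‖(EuclideanSpace.proj (2 : Fin 3) : EuclideanSpace ℝ (Fin 3) →L[ℝ] ℝ).comp (fderiv ℝ V y)‖
        ≤ ‖(EuclideanSpace.proj (2 : Fin 3) : EuclideanSpace ℝ (Fin 3) →L[ℝ] ℝ)‖ * ‖fderiv ℝ V y‖ :=
          ContinuousLinearMap.opNorm_comp_le _ _
      _ ≤ 1 * ‖fderiv ℝ V y‖ := mul_le_mul_of_nonneg_right norm_proj_two_le (norm_nonneg _)
      _ = ‖fderiv ℝ V y‖ := one_mul _
  · rw [norm_smul, norm_smul, Real.norm_eq_abs, Real.norm_eq_abs]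
    calc |V y 2| * (|deriv (deriv g) (y 2)| * ‖(EuclideanSpace.proj (2 : Fin 3) : EuclideanSpace ℝ (Fin 3) →L[ℝ] ℝ)‖)
        ≤ ‖V y‖ * (Kγ' * 1) :=
          mul_le_mul (abs_apply_le_norm _ 2) (mul_le_mul (hKγ' (y 2)) norm_proj_two_le (norm_nonneg _)
            ((abs_nonneg (deriv (deriv g) 0)).trans (hKγ' 0))) (by positivity) (norm_nonneg _)
      _ = Kγ' * ‖V y‖ := by ring

/-- **Uniform bounds for the discrete slide direction**: with `|g| ≤ K_g`, `|g′| ≤ K_γ`, `|g″| ≤ K_γ′`, `‖V‖ ≤ C_V`,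
`‖DV‖ ≤ B`: `‖φ̂_h(x)‖ ≤ 2K_gC_V + |h|K_γC_V` and `‖Dφ̂_h(x)‖ ≤ 2(K_gB + K_γC_V) + |h|(K_γB + K_γ′C_V)`. [folklore] -/
theorem norm_slideQuotient_le (hV : ContDiff ℝ 1 V) (hg : ContDiff ℝ 2 g) {Kg Kγ Kγ' Cv B : ℝ}
    (hKg : ∀ s, |g s| ≤ Kg) (hKγ : ∀ s, |deriv g s| ≤ Kγ) (hKγ' : ∀ s, |deriv (deriv g) s| ≤ Kγ')
    (hCv : ∀ y, ‖V y‖ ≤ Cv) (hB : ∀ y, ‖fderiv ℝ V y‖ ≤ B) (h : ℝ) (x : EuclideanSpace ℝ (Fin 3)) :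
    ‖g (x 2) • V x - g ((x + (-h) • EuclideanSpace.single (2 : Fin 3) (1 : ℝ)) 2) •
          V (x + (-h) • EuclideanSpace.single (2 : Fin 3) (1 : ℝ)) -
        (∫ t in (-h)..0, deriv g ((x + t • EuclideanSpace.single (2 : Fin 3) (1 : ℝ)) 2) *
            V (x + t • EuclideanSpace.single (2 : Fin 3) (1 : ℝ)) 2) • EuclideanSpace.single (2 : Fin 3) (1 : ℝ)‖ ≤
      2 * (Kg * Cv) + |h| * (Kγ * Cv) ∧
    ‖fderiv ℝ (fun x : EuclideanSpace ℝ (Fin 3) => g (x 2) • V x - g ((x + (-h) • EuclideanSpace.single (2 : Fin 3) (1 : ℝ)) 2) •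
          V (x + (-h) • EuclideanSpace.single (2 : Fin 3) (1 : ℝ)) -
        (∫ t in (-h)..0, deriv g ((x + t • EuclideanSpace.single (2 : Fin 3) (1 : ℝ)) 2) *
            V (x + t • EuclideanSpace.single (2 : Fin 3) (1 : ℝ)) 2) • EuclideanSpace.single (2 : Fin 3) (1 : ℝ)) x‖ ≤
      2 * (Kg * B + Kγ * Cv) + |h| * (Kγ * B + Kγ' * Cv) := by
  set e₂ : EuclideanSpace ℝ (Fin 3) := EuclideanSpace.single (2 : Fin 3) (1 : ℝ) with he₂
  have hVd : Differentiable ℝ V := hV.differentiable one_ne_zero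
  have hgd : Differentiable ℝ g := hg.differentiable two_ne_zero
  have hg'c : ContDiff ℝ 1 (deriv g) := by
    have h2 : ContDiff ℝ (1 + 1) g := by rw [show ((1 : WithTop ℕ∞) + 1) = 2 by norm_num]; exact hg
    exact h2.deriv'
  have hγd : Differentiable ℝ (deriv g) := hg'c.differentiable one_ne_zero
  have he₂n : ‖e₂‖ = 1 := by rw [he₂, PiLp.norm_single, norm_one]
  set Ψ : EuclideanSpace ℝ (Fin 3) → EuclideanSpace ℝ (Fin 3) := fun y => g (y 2) • V y with hΨ
  set G : EuclideanSpace ℝ (Fin 3) → ℝ := fun y => deriv g (y 2) * V y 2 with hG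
  set F : EuclideanSpace ℝ (Fin 3) → ℝ := fun y => ∫ t in (-h)..0, G (y + t • e₂) with hF
  have hGc : ContDiff ℝ 1 G := by
    have h1 : ContDiff ℝ 1 fun y : EuclideanSpace ℝ (Fin 3) => deriv g (y 2) :=
      hg'c.comp ((EuclideanSpace.proj (2 : Fin 3) : EuclideanSpace ℝ (Fin 3) →L[ℝ] ℝ).contDiff)
    have h2 : ContDiff ℝ 1 fun y : EuclideanSpace ℝ (Fin 3) => V y 2 :=
      (EuclideanSpace.proj (2 : Fin 3) : EuclideanSpace ℝ (Fin 3) →L[ℝ] ℝ).contDiff.comp hV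
    exact h1.mul h2
  -- pointwise sizes
  have hKg0 : 0 ≤ Kg := (abs_nonneg (g 0)).trans (hKg 0)
  have hKγ0 : 0 ≤ Kγ := (abs_nonneg (deriv g 0)).trans (hKγ 0)
  have hΨn : ∀ y, ‖Ψ y‖ ≤ Kg * Cv := fun y => by
    simp only [hΨ]; rw [norm_smul, Real.norm_eq_abs]
    exact mul_le_mul (hKg (y 2)) (hCv y) (norm_nonneg _) hKg0
  have hGn : ∀ y, ‖G y‖ ≤ Kγ * Cv := fun y => by
    simp only [hG]; rw [norm_mul, Real.norm_eq_abs, Real.norm_eq_abs]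
    exact mul_le_mul (hKγ (y 2)) ((abs_apply_le_norm _ 2).trans (hCv y)) (abs_nonneg _) hKγ0
  have hFn : ‖F x‖ ≤ |h| * (Kγ * Cv) := by
    have h1 := intervalIntegral.norm_integral_le_of_norm_le_const (a := -h) (b := 0) (C := Kγ * Cv)
      (f := fun t => G (x + t • e₂)) fun t _ => hGn _
    simp only [sub_neg_eq_add, zero_add] at h1
    rw [show |h| * (Kγ * Cv) = Kγ * Cv * |h| by ring]
    exact h1
  have hDΨn : ∀ y, ‖fderiv ℝ Ψ y‖ ≤ Kg * B + Kγ * Cv := fun y =>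
    (norm_fderiv_axialWeight_smul_le hVd hgd hKg hKγ y).trans
      (add_le_add (mul_le_mul_of_nonneg_left (hB y) hKg0) (mul_le_mul_of_nonneg_left (hCv y) hKγ0))
  have hDGn : ∀ y, ‖fderiv ℝ G y‖ ≤ Kγ * B + Kγ' * Cv := fun y =>
    (norm_fderiv_axialWeight_mul_coord_le hVd hγd hKγ hKγ' y).trans
      (add_le_add (mul_le_mul_of_nonneg_left (hB y) hKγ0)
        (mul_le_mul_of_nonneg_left (hCv y) ((abs_nonneg (deriv (deriv g) 0)).trans (hKγ' 0))))
  have hDFn : ‖fderiv ℝ F x‖ ≤ |h| * (Kγ * B + Kγ' * Cv) := by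
    simp only [hF]
    rw [fderiv_verticalIntegral_eq hGc (-h) 0 x]
    have h1 := intervalIntegral.norm_integral_le_of_norm_le_const (a := -h) (b := 0) (C := Kγ * B + Kγ' * Cv)
      (f := fun t => fderiv ℝ G (x + t • e₂)) fun t _ => hDGn _
    simp only [sub_neg_eq_add, zero_add] at h1
    rw [show |h| * (Kγ * B + Kγ' * Cv) = (Kγ * B + Kγ' * Cv) * |h| by ring]
    exact h1
  -- differentiability of the pieces
  have hΨd : Differentiable ℝ Ψ := fun y => (hasFDerivAt_axialWeight_smul hVd hgd y).differentiableAt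
  have hΨad : Differentiable ℝ fun y => Ψ (y + (-h) • e₂) := hΨd.comp (differentiable_id.add_const _)
  have hFd : Differentiable ℝ F := differentiable_verticalIntegral hGc (-h) 0
  have hFe : Differentiable ℝ fun y => F y • e₂ := hFd.smul_const e₂
  have hfun : (fun y : EuclideanSpace ℝ (Fin 3) => g (y 2) • V y - g ((y + (-h) • e₂) 2) • V (y + (-h) • e₂) -
      (∫ t in (-h)..0, deriv g ((y + t • e₂) 2) * V (y + t • e₂) 2) • e₂) =
      fun y => Ψ y - Ψ (y + (-h) • e₂) - F y • e₂ := rfl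
  refine ⟨?_, ?_⟩
  · show ‖Ψ x - Ψ (x + (-h) • e₂) - F x • e₂‖ ≤ _
    have h1 : ‖F x • e₂‖ ≤ |h| * (Kγ * Cv) := by rw [norm_smul, he₂n, mul_one]; exact hFn
    calc ‖Ψ x - Ψ (x + (-h) • e₂) - F x • e₂‖ ≤ ‖Ψ x - Ψ (x + (-h) • e₂)‖ + ‖F x • e₂‖ := norm_sub_le _ _
      _ ≤ (‖Ψ x‖ + ‖Ψ (x + (-h) • e₂)‖) + ‖F x • e₂‖ := by gcongr; exact norm_sub_le _ _
      _ ≤ (Kg * Cv + Kg * Cv) + |h| * (Kγ * Cv) := add_le_add (add_le_add (hΨn _) (hΨn _)) h1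
      _ = 2 * (Kg * Cv) + |h| * (Kγ * Cv) := by ring
  · have hΨΨad : Differentiable ℝ fun y => Ψ y - Ψ (y + (-h) • e₂) := hΨd.sub hΨad
    rw [hfun, fderiv_fun_sub (hΨΨad x) (hFe x), fderiv_fun_sub (hΨd x) (hΨad x), fderiv_comp_add_right,
      fderiv_smul_const (hFd x)]
    have h1 : ‖(fderiv ℝ F x).smulRight e₂‖ ≤ |h| * (Kγ * B + Kγ' * Cv) := by
      rw [ContinuousLinearMap.norm_smulRight_apply, he₂n, mul_one]; exact hDFn
    calc ‖fderiv ℝ Ψ x - fderiv ℝ Ψ (x + (-h) • e₂) - (fderiv ℝ F x).smulRight e₂‖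
        ≤ ‖fderiv ℝ Ψ x - fderiv ℝ Ψ (x + (-h) • e₂)‖ + ‖(fderiv ℝ F x).smulRight e₂‖ := norm_sub_le _ _
      _ ≤ (‖fderiv ℝ Ψ x‖ + ‖fderiv ℝ Ψ (x + (-h) • e₂)‖) + ‖(fderiv ℝ F x).smulRight e₂‖ := by
          gcongr; exact norm_sub_le _ _
      _ ≤ ((Kg * B + Kγ * Cv) + (Kg * B + Kγ * Cv)) + |h| * (Kγ * B + Kγ' * Cv) :=
          add_le_add (add_le_add (hDΨn _) (hDΨn _)) h1
      _ = 2 * (Kg * B + Kγ * Cv) + |h| * (Kγ * B + Kγ' * Cv) := by ring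

/-! ## 5. Inward pointing on a far layer (global form of `inner_slideQuotient_nonneg`) -/

/-- **Global inwardness on a far layer**: if `g′ = 0` off `[−T, T]` and `‖V‖² ≤ 2‖c‖²` on the thickened layer
`{|x₂| ≤ T + h}`, then `⟪c + V(x), φ̂_h(x)⟫ ≥ 0` at EVERY `x` (outside the thickened layer the sliding integral vanishes
and the two remaining pieces are nonnegative by Cauchy–Schwarz and monotonicity of `g`). [folklore] -/
theorem inner_slideQuotient_nonneg_of_farLayer (hVc : ∀ y, ⟪V y, c⟫ = -(‖V y‖ ^ 2 / 2)) (hc0 : c 0 = 0) (hc1 : c 1 = 0)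
    (hc : 0 < ‖c‖) (hgd : Differentiable ℝ g) (hg0 : ∀ s, 0 ≤ g s) (hγ0 : ∀ s, 0 ≤ deriv g s)
    {T h : ℝ} (hh : 0 ≤ h) (hT1 : ∀ s, T < |s| → deriv g s = 0)
    (hfar : ∀ x : EuclideanSpace ℝ (Fin 3), |x 2| ≤ T + h → ‖V x‖ ^ 2 ≤ 2 * ‖c‖ ^ 2) (x : EuclideanSpace ℝ (Fin 3)) :
    0 ≤ ⟪c + V x, g (x 2) • V x - g ((x + (-h) • EuclideanSpace.single (2 : Fin 3) (1 : ℝ)) 2) •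
          V (x + (-h) • EuclideanSpace.single (2 : Fin 3) (1 : ℝ)) -
        (∫ t in (-h)..0, deriv g ((x + t • EuclideanSpace.single (2 : Fin 3) (1 : ℝ)) 2) *
            V (x + t • EuclideanSpace.single (2 : Fin 3) (1 : ℝ)) 2) • EuclideanSpace.single (2 : Fin 3) (1 : ℝ)⟫ := by
  by_cases hx : |x 2| ≤ T + h
  · exact inner_slideQuotient_nonneg hVc hc0 hc1 hc hgd hg0 hγ0 hh (hfar x hx)
  set e₂ : EuclideanSpace ℝ (Fin 3) := EuclideanSpace.single (2 : Fin 3) (1 : ℝ) with he₂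
  have hx' : T + h < |x 2| := not_le.1 hx
  -- the sliding integral vanishes off the thickened layer
  have hF : (∫ t in (-h)..0, deriv g ((x + t • e₂) 2) * V (x + t • e₂) 2) = 0 := by
    have hzero : EqOn (fun t : ℝ => deriv g ((x + t • e₂) 2) * V (x + t • e₂) 2) (fun _ => 0) (uIcc (-h) 0) := by
      intro t ht
      rw [uIcc_of_le (neg_nonpos.2 hh)] at ht
      have h2 : (x + t • e₂) 2 = x 2 + t := by simp [he₂]
      have hT' : T < |x 2 + t| := by
        have h3 : |x 2| ≤ |x 2 + t| + |t| := by
          have := abs_add_le (x 2 + t) (-t); simp only [add_neg_cancel_right, abs_neg] at this; exact this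
        have h4 : |t| ≤ h := abs_le.2 ⟨by linarith [ht.1], by linarith [ht.2]⟩
        linarith
      show deriv g ((x + t • e₂) 2) * V (x + t • e₂) 2 = 0
      rw [h2, hT1 _ hT', zero_mul]
    rw [intervalIntegral.integral_congr hzero, intervalIntegral.integral_zero]
  rw [hF, zero_smul, sub_zero]
  -- the two remaining pieces
  have hM : ∀ y, ‖c + V y‖ = ‖c‖ := fun y => (coord_two_mul_coord_two_eq hVc hc0 hc1 y).2
  set a : EuclideanSpace ℝ (Fin 3) := (-h) • e₂ with ha
  have hwV : ⟪c + V x, V x⟫ = ‖V x‖ ^ 2 / 2 := by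
    rw [inner_add_left, real_inner_self_eq_norm_sq, real_inner_comm, hVc]; ring
  have hT1' : ⟪c + V x, V (x + a)⟫ ≤ ‖V x‖ ^ 2 / 2 := by
    have h0 := inner_self_sub_translate_nonneg (w := fun y => c + V y) hM x (x + a)
    have e : (c + V x) - (c + V (x + a)) = V x - V (x + a) := by abel
    simp only [e, inner_sub_right] at h0
    linarith [hwV]
  have ha2 : (x + a) 2 = x 2 - h := by
    simp [ha, he₂]; ring
  have hmono : g (x 2 - h) ≤ g (x 2) := (monotone_of_deriv_nonneg hgd hγ0) (by linarith)
  rw [inner_sub_right, real_inner_smul_right, real_inner_smul_right, hwV, ha2]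
  have h2 : g (x 2 - h) * ⟪c + V x, V (x + a)⟫ ≤ g (x 2 - h) * (‖V x‖ ^ 2 / 2) :=
    mul_le_mul_of_nonneg_left hT1' (hg0 _)
  nlinarith [hmono, h2, sq_nonneg ‖V x‖, hg0 (x 2 - h)]

end ExtremiserLiouville

end Summit.NavierStokesRegularity.NavierStokesRegularity.Theorems

end
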